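import Summits.ABC.IUTFork.Repair.RHSigmaLicence
import HarnessLib

/-!
# R-H ROUND 2, Q2 (generic): INVARIANCE OF THE OFF-Σ REMAINDER — every licensed stratum pays the SAME number `R_∅`

abc-iut cell, rung LADDER-ABC:A2.RESCUE.H, R-H ROUND 2 seat abc-iut-rh2-q2-eq (gen 2; rows 3/4/5, the EQUIVALENCE / locator rows). Sequel of
`RHSigmaLicence.lean` (p468453: `LicenceOn`, `licenceCells`, `cellDeficit`, `offRemainder`, `StatementUpTo`,
`statementUpTo_offRemainder_of_licenceOn`), at the same generality: ANY Θ-index, ANY situation, ANY setting `P : Cor312.Setting S` of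
abc-iut-c312-7, under abc-iut-c312-6's bridge hypotheses `BridgeHyps P` where a log-volume comparison is needed.

THE POINT (one line): the licence at a cell forces that cell's deficit to be `≤ 0` (monotone log-volume), so a LICENSED stratum `σ` never removes a
positive term from the remainder — **`LicenceOn P σ ⟹ R_σ(P) = R_∅(P)`** (`offRemainder_eq_offRemainder_empty_of_licenceOn`), where
`R_∅(P) = (1/l⋇)·Σ_j Σ_{v_ℚ} (cellDeficit)⁺` is the TOTAL POSITIVE CELL DEFICIT of the setting (`offRemainder_empty_eq`). Consequences, all PROVED:
* `offRemainder_add_offRemainder_compl`: `R_σ + R_{σᶜ} = R_∅` for every `σ` (off-σ charge + on-σ charge = total), so `R_σ ≤ R_∅` always and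
  `R_σ = R_∅ ⟺` no cell of `σ` has a positive deficit (`offRemainder_eq_offRemainder_empty_iff`; strict `<` as soon as one cell of `σ` has a
  positive deficit, `offRemainder_lt_offRemainder_empty_of_pos`).
* `statementUpTo_offRemainder_empty`: **Cor. 3.12 WEAKENED BY `R_∅` holds under the bridge hypotheses ALONE** (the empty stratum is licensed
  vacuously) — and for every licensed `σ` the sentence «S|σ ⟹ Cor. 3.12 up to `R_σ`» of p468453 is LITERALLY this one sentence
  (`statementUpTo_offRemainder_iff_of_licenceOn`). In particular the round-2 kernel targets of rows 3/4/5 (Σ₃ under S|Σ₃, Σ₄, Σ₅, Σ₅♭) and of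
  every other row whose restricted licence is proved or assumed all weaken Cor. 3.12 by the SAME number `R_∅(T)` per datum.
* What a licence DOES buy is LOCALISATION of the upper bounds: `R_∅ = R_σ ≤` the off-σ image gap along any choice of possible images
  (`offRemainder_empty_le_offImageGap_of_licenceOn`, hull-free), and a remainder budget is one binder for all rows:
  `offRemainder_le_iff_of_licenceOn` («`R_σ ≤ ε` ⟺ `R_∅ ≤ ε`» under `LicenceOn σ`).
* Branch C vocabulary (`PilotKummerCompatHullOn`, q-pin): the same invariance (`offRemainder_eq_offRemainder_empty_of_pilotKummerCompatHullOn`).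

HONEST FRAMING: reading predicates and real numbers about OUR typed objects; nothing here asserts that abc is proved or refuted, or that
[IUTchIII] Cor. 3.12 holds or fails at any datum, or takes a side on any author (Mochizuki / Scholze–Stix / Joshi / Dupuy–Hilado); `R_∅` is
DEFINED and compared, never bounded numerically here; typed ≠ proved; refuted-as-typed ≠ refuted-in-print. [claim: Mochizuki2012, status: disputed]
for every IUT locution. [cite: Mochizuki2012, IUTchIII Cor. 3.12 p. 173–174, Step (xi-f) p. 184, Prop. 3.9 (i)(iii) p. 116]
-/

noncomputable section

open Set Function

namespace Summit.ABC.IUTFork.Repair.RH.SigmaLicence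

open Summit.ABC.IUTFork.Thm311 Summit.ABC.IUTFork.Cor312 Summit.ABC.IUTFork.Cor312.Setting Summit.ABC.IUTFork.Cor312Vol
  Literature.IUT.LogThetaLattice

variable {T : ThetaIndex} {S : Situation T} {P : Cor312.Setting S}

/-! ## §1. The licence kills the positive deficit of its own cells -/

/-- The empty stratum is licensed, vacuously: «S restricted to ∅» asks nothing. [folklore] -/
theorem licenceOn_empty : LicenceOn P (∅ : Set (Fin T.lstar × T.VQ)) := fun _ h => h.elim

/-- At a licence cell the deficit is `≤ 0`: the q-region lies in the hull, both are admissible, and the log-volume is monotone.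
[claim: Mochizuki2012, status: disputed] -/
theorem cellDeficit_nonpos_of_mem_licenceCells (H : BridgeHyps P) {t : Fin T.lstar × T.VQ} (ht : t ∈ licenceCells P) :
    cellDeficit P t.1 t.2 ≤ 0 := by
  have h : P.qLocal (labelSucc t.1) t.2 ≤ (S.D P.n).logvol (labelSucc t.1) t.2 (P.thetaHull (labelSucc t.1) t.2) :=
    H.mono t.1 t.2 (P.hul_adm _ t.2 _ (P.qRegion_mem _ t.2)) (P.thetaHull_adm (hullDefined_of_finite H t.1 t.2)) ht
  unfold cellDeficit
  linarith

/-- On a licensed stratum every cell has deficit `≤ 0`. [claim: Mochizuki2012, status: disputed] -/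
theorem cellDeficit_nonpos_of_licenceOn (H : BridgeHyps P) {σ : Set (Fin T.lstar × T.VQ)} (hσ : LicenceOn P σ)
    {t : Fin T.lstar × T.VQ} (ht : t ∈ σ) : cellDeficit P t.1 t.2 ≤ 0 :=
  cellDeficit_nonpos_of_mem_licenceCells H (hσ t ht)

/-- Hence the positive part of the deficit VANISHES on a licensed stratum. [claim: Mochizuki2012, status: disputed] -/
theorem posDeficit_eq_zero_of_licenceOn (H : BridgeHyps P) {σ : Set (Fin T.lstar × T.VQ)} (hσ : LicenceOn P σ)
    {t : Fin T.lstar × T.VQ} (ht : t ∈ σ) : max (cellDeficit P t.1 t.2) 0 = 0 :=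
  max_eq_right (cellDeficit_nonpos_of_licenceOn H hσ ht)

/-! ## §2. The total positive deficit `R_∅` and the decomposition `R_σ + R_{σᶜ} = R_∅` -/

/-- **`R_∅` in closed form: the TOTAL POSITIVE CELL DEFICIT** `(1/l⋇)·Σ_j Σ_{v_ℚ} (cellDeficit)⁺` (no indicator).
[claim: Mochizuki2012, status: disputed] -/
theorem offRemainder_empty_eq (P : Cor312.Setting S) :
    offRemainder P ∅ = processionNormalized fun i : Fin T.lstar => ∑ᶠ vQ : T.VQ, max (cellDeficit P i vQ) 0 := by
  unfold offRemainder
  simp only [Set.compl_empty, Set.indicator_univ]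

/-- `R_{σᶜ}` is the positive deficit carried BY the cells of `σ` (the «on-σ charge»). [claim: Mochizuki2012, status: disputed] -/
theorem offRemainder_compl_eq (P : Cor312.Setting S) (σ : Set (Fin T.lstar × T.VQ)) :
    offRemainder P σᶜ = processionNormalized fun i : Fin T.lstar =>
      ∑ᶠ vQ : T.VQ, σ.indicator (fun t : Fin T.lstar × T.VQ => max (cellDeficit P t.1 t.2) 0) (i, vQ) := by
  unfold offRemainder
  simp only [compl_compl]

/-- Per label, the on-σ summand is finitely supported over `v_ℚ`. [folklore] -/
theorem indicator_self_deficit_support_finite (H : BridgeHyps P) (σ : Set (Fin T.lstar × T.VQ)) (i : Fin T.lstar) :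
    (Function.support fun vQ : T.VQ =>
      σ.indicator (fun t : Fin T.lstar × T.VQ => max (cellDeficit P t.1 t.2) 0) (i, vQ)).Finite := by
  simpa only [compl_compl] using indicator_deficit_support_finite H σᶜ i

/-- **DECOMPOSITION: off-σ charge + on-σ charge = total positive deficit**, `R_σ + R_{σᶜ} = R_∅`, for EVERY stratum `σ` (licensed or not).
[claim: Mochizuki2012, status: disputed] -/
theorem offRemainder_add_offRemainder_compl (H : BridgeHyps P) (σ : Set (Fin T.lstar × T.VQ)) :
    offRemainder P σ + offRemainder P σᶜ = offRemainder P ∅ := by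
  rw [offRemainder_compl_eq, offRemainder_empty_eq]
  unfold offRemainder processionNormalized
  rw [← add_div, ← Finset.sum_add_distrib]
  congr 1
  refine Finset.sum_congr rfl fun i _ => ?_
  rw [← finsum_add_distrib (indicator_deficit_support_finite H σ i) (indicator_self_deficit_support_finite H σ i)]
  exact finsum_congr fun vQ =>
    Set.indicator_compl_add_self_apply σ (fun t : Fin T.lstar × T.VQ => max (cellDeficit P t.1 t.2) 0) (i, vQ)

/-- `R_∅` is the MAXIMUM charge: `R_σ ≤ R_∅` for every `σ`. [claim: Mochizuki2012, status: disputed] -/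
theorem offRemainder_le_offRemainder_empty (H : BridgeHyps P) (σ : Set (Fin T.lstar × T.VQ)) :
    offRemainder P σ ≤ offRemainder P ∅ :=
  offRemainder_anti H (Set.empty_subset σ)

/-- The on-σ charge as a difference: `R_{σᶜ} = R_∅ − R_σ`. [claim: Mochizuki2012, status: disputed] -/
theorem offRemainder_compl_eq_sub (H : BridgeHyps P) (σ : Set (Fin T.lstar × T.VQ)) :
    offRemainder P σᶜ = offRemainder P ∅ - offRemainder P σ := by
  rw [← offRemainder_add_offRemainder_compl H σ, add_sub_cancel_left]

/-! ## §3. INVARIANCE: a stratum without positive deficits — in particular any LICENSED stratum — pays exactly `R_∅` -/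

/-- If no cell of `σ` has a positive deficit, the on-σ charge vanishes. [claim: Mochizuki2012, status: disputed] -/
theorem offRemainder_compl_eq_zero_of_forall_nonpos {σ : Set (Fin T.lstar × T.VQ)}
    (h : ∀ t ∈ σ, cellDeficit P t.1 t.2 ≤ 0) : offRemainder P σᶜ = 0 :=
  offRemainder_eq_zero_of_forall fun t ht => h t (Set.notMem_compl_iff.mp ht)

/-- … and then `R_σ = R_∅`. [claim: Mochizuki2012, status: disputed] -/
theorem offRemainder_eq_offRemainder_empty_of_forall_nonpos (H : BridgeHyps P) {σ : Set (Fin T.lstar × T.VQ)}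
    (h : ∀ t ∈ σ, cellDeficit P t.1 t.2 ≤ 0) : offRemainder P σ = offRemainder P ∅ := by
  rw [← offRemainder_add_offRemainder_compl H σ, offRemainder_compl_eq_zero_of_forall_nonpos h, add_zero]

/-- A licensed stratum carries no on-σ charge: `LicenceOn P σ ⟹ R_{σᶜ} = 0`. [claim: Mochizuki2012, status: disputed] -/
theorem offRemainder_compl_eq_zero_of_licenceOn (H : BridgeHyps P) {σ : Set (Fin T.lstar × T.VQ)} (hσ : LicenceOn P σ) :
    offRemainder P σᶜ = 0 :=
  offRemainder_compl_eq_zero_of_forall_nonpos fun _ ht => cellDeficit_nonpos_of_licenceOn H hσ ht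

/-- **INVARIANCE OF THE REMAINDER (R-H ROUND 2 Q2, all rows at once): every LICENSED stratum pays the SAME number, the total positive
deficit — `LicenceOn P σ ⟹ R_σ = R_∅`.** The licence removes from the remainder only cells whose positive deficit is already `0`.
(abc-iut-rh2-q2-eq gen 0's `offRemainder_sigmaNu_le` / `offRemainder_anti` gave `≥`; this is the equality.) [claim: Mochizuki2012, status: disputed] -/
theorem offRemainder_eq_offRemainder_empty_of_licenceOn (H : BridgeHyps P) {σ : Set (Fin T.lstar × T.VQ)} (hσ : LicenceOn P σ) :
    offRemainder P σ = offRemainder P ∅ :=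
  offRemainder_eq_offRemainder_empty_of_forall_nonpos H fun _ ht => cellDeficit_nonpos_of_licenceOn H hσ ht

/-- The licence cells themselves pay `R_∅`: `R_{Σ_lic} = R_∅` (the cells where OUR typed licence fails carry ALL the positive deficit).
[claim: Mochizuki2012, status: disputed] -/
theorem offRemainder_licenceCells_eq_offRemainder_empty (H : BridgeHyps P) :
    offRemainder P (licenceCells P) = offRemainder P ∅ :=
  offRemainder_eq_offRemainder_empty_of_licenceOn H licenceOn_licenceCells

/-- Any licensed stratum pays what the licence cells pay: `R_σ = R_{Σ_lic}`. [claim: Mochizuki2012, status: disputed] -/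
theorem offRemainder_eq_offRemainder_licenceCells_of_licenceOn (H : BridgeHyps P) {σ : Set (Fin T.lstar × T.VQ)}
    (hσ : LicenceOn P σ) : offRemainder P σ = offRemainder P (licenceCells P) := by
  rw [offRemainder_eq_offRemainder_empty_of_licenceOn H hσ, offRemainder_licenceCells_eq_offRemainder_empty H]

/-- Any TWO licensed strata pay the same: `R_σ = R_σ'`. [claim: Mochizuki2012, status: disputed] -/
theorem offRemainder_eq_of_licenceOn (H : BridgeHyps P) {σ σ' : Set (Fin T.lstar × T.VQ)} (hσ : LicenceOn P σ)
    (hσ' : LicenceOn P σ') : offRemainder P σ = offRemainder P σ' := by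
  rw [offRemainder_eq_offRemainder_empty_of_licenceOn H hσ, offRemainder_eq_offRemainder_empty_of_licenceOn H hσ']

/-! ## §4. The ONE sentence: Cor. 3.12 weakened by the total positive deficit, under the bridge hypotheses alone -/

/-- **Cor. 3.12 WEAKENED BY `R_∅` — NO stratum, NO licence hypothesis**: under the bridge hypotheses `−|log(Θ)| ∈ ℝ` and
`−|log(q)| ≤ −|log(Θ)| + R_∅` (the empty stratum is licensed vacuously). Every «S|σ ⟹ Cor. 3.12 up to `R_σ`» with `σ` licensed is this
sentence verbatim (`statementUpTo_offRemainder_iff_of_licenceOn`). [claim: Mochizuki2012, status: disputed] -/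
theorem statementUpTo_offRemainder_empty (H : BridgeHyps P) : StatementUpTo P (offRemainder P ∅) :=
  statementUpTo_offRemainder_of_licenceOn H licenceOn_empty

/-- The same sentence with `R_∅` in closed form (total positive deficit, no indicator). [claim: Mochizuki2012, status: disputed] -/
theorem statementUpTo_totalPosDeficit (H : BridgeHyps P) :
    StatementUpTo P (processionNormalized fun i : Fin T.lstar => ∑ᶠ vQ : T.VQ, max (cellDeficit P i vQ) 0) := by
  rw [← offRemainder_empty_eq]
  exact statementUpTo_offRemainder_empty H

/-- For a licensed stratum the weakened statement «up to `R_σ`» IS the weakened statement «up to `R_∅`». [claim: Mochizuki2012, status: disputed] -/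
theorem statementUpTo_offRemainder_iff_of_licenceOn (H : BridgeHyps P) {σ : Set (Fin T.lstar × T.VQ)} (hσ : LicenceOn P σ) :
    StatementUpTo P (offRemainder P σ) ↔ StatementUpTo P (offRemainder P ∅) := by
  rw [offRemainder_eq_offRemainder_empty_of_licenceOn H hσ]

/-- For an ARBITRARY stratum the weakened statement «up to `R_σ`» implies the one «up to `R_∅`» (`R_σ ≤ R_∅`); the converse is the content
of a licence on `σ`. [claim: Mochizuki2012, status: disputed] -/
theorem statementUpTo_offRemainder_empty_of_statementUpTo_offRemainder (H : BridgeHyps P) {σ : Set (Fin T.lstar × T.VQ)}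
    (h : StatementUpTo P (offRemainder P σ)) : StatementUpTo P (offRemainder P ∅) :=
  statementUpTo_mono (offRemainder_le_offRemainder_empty H σ) h

/-! ## §5. What a licence DOES buy: localisation of the upper bounds, and ONE budget binder for all rows -/

/-- **Localisation**: under `LicenceOn P σ` the total positive deficit is supported OFF `σ`, hence bounded by the off-σ IMAGE GAP along any
global choice of possible images (idele-only, no hull inside; p468453 `offRemainder_le_offImageGap`). [claim: Mochizuki2012, status: disputed] -/
theorem offRemainder_empty_le_offImageGap_of_licenceOn (H : BridgeHyps P) {σ : Set (Fin T.lstar × T.VQ)} (hσ : LicenceOn P σ)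
    (U : ImageChoice P) : offRemainder P ∅ ≤ offImageGap P σ U := by
  rw [← offRemainder_eq_offRemainder_empty_of_licenceOn H hσ]
  exact offRemainder_le_offImageGap H σ U

/-- **One budget binder for all rows**: under `LicenceOn P σ`, «`R_σ ≤ ε`» ⟺ «`R_∅ ≤ ε`». [claim: Mochizuki2012, status: disputed] -/
theorem offRemainder_le_iff_of_licenceOn (H : BridgeHyps P) {σ : Set (Fin T.lstar × T.VQ)} (hσ : LicenceOn P σ) (ε : ℝ) :
    offRemainder P σ ≤ ε ↔ offRemainder P ∅ ≤ ε := by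
  rw [offRemainder_eq_offRemainder_empty_of_licenceOn H hσ]

/-- A budget on `R_∅` is a budget on every `R_σ` (no licence needed). [claim: Mochizuki2012, status: disputed] -/
theorem offRemainder_le_of_offRemainder_empty_le (H : BridgeHyps P) (σ : Set (Fin T.lstar × T.VQ)) {ε : ℝ}
    (hε : offRemainder P ∅ ≤ ε) : offRemainder P σ ≤ ε :=
  (offRemainder_le_offRemainder_empty H σ).trans hε

/-- A budget on a LICENSED `R_σ` is a budget on `R_∅`. [claim: Mochizuki2012, status: disputed] -/
theorem offRemainder_empty_le_of_licenceOn_of_le (H : BridgeHyps P) {σ : Set (Fin T.lstar × T.VQ)} (hσ : LicenceOn P σ) {ε : ℝ}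
    (hε : offRemainder P σ ≤ ε) : offRemainder P ∅ ≤ ε :=
  (offRemainder_le_iff_of_licenceOn H hσ ε).mp hε

/-- Budget form of the one sentence: `R_∅ ≤ ε ⟹` Cor. 3.12 weakened by `ε` (bridge hypotheses only). [claim: Mochizuki2012, status: disputed] -/
theorem statementUpTo_of_offRemainder_empty_le (H : BridgeHyps P) {ε : ℝ} (hε : offRemainder P ∅ ≤ ε) : StatementUpTo P ε :=
  statementUpTo_mono hε (statementUpTo_offRemainder_empty H)

/-- `R_∅ ≤ 0` (i.e. NO cell has a positive deficit) ⟹ the PRINTED Statement of Cor. 3.12. [claim: Mochizuki2012, status: disputed] -/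
theorem statement_of_offRemainder_empty_nonpos (H : BridgeHyps P) (h0 : offRemainder P ∅ ≤ 0) : P.Statement :=
  statement_of_statementUpTo_nonpos h0 (statementUpTo_offRemainder_empty H)

/-! ## §6. Strictness: an UNLICENSED stratum pays strictly less exactly when one of its cells has a positive deficit -/

/-- `0 < l⋇` as soon as a cell exists. [folklore] -/
theorem lstar_pos_of_cell (t : Fin T.lstar × T.VQ) : (0 : ℝ) < T.lstar := by
  exact_mod_cast Fin.pos t.1

/-- A cell of `σ` with a positive deficit makes the on-σ charge positive: `0 < R_{σᶜ}`. [claim: Mochizuki2012, status: disputed] -/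
theorem offRemainder_compl_pos_of_pos (H : BridgeHyps P) {σ : Set (Fin T.lstar × T.VQ)} {t : Fin T.lstar × T.VQ} (ht : t ∈ σ)
    (hpos : 0 < cellDeficit P t.1 t.2) : 0 < offRemainder P σᶜ := by
  rw [offRemainder_compl_eq]
  unfold processionNormalized
  refine div_pos ?_ (lstar_pos_of_cell t)
  have hnn : ∀ (i : Fin T.lstar) (vQ : T.VQ),
      0 ≤ σ.indicator (fun t : Fin T.lstar × T.VQ => max (cellDeficit P t.1 t.2) 0) (i, vQ) :=
    fun i vQ => Set.indicator_nonneg (fun _ _ => le_max_right _ _) _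
  have hterm : σ.indicator (fun t : Fin T.lstar × T.VQ => max (cellDeficit P t.1 t.2) 0) (t.1, t.2) =
      max (cellDeficit P t.1 t.2) 0 := Set.indicator_of_mem (show (t.1, t.2) ∈ σ from ht) _
  have h1 : max (cellDeficit P t.1 t.2) 0 ≤
      ∑ᶠ vQ : T.VQ, σ.indicator (fun t : Fin T.lstar × T.VQ => max (cellDeficit P t.1 t.2) 0) (t.1, vQ) := by
    rw [← hterm]
    exact single_le_finsum t.2 (indicator_self_deficit_support_finite H σ t.1) (hnn t.1)
  have h2 : (∑ᶠ vQ : T.VQ, σ.indicator (fun t : Fin T.lstar × T.VQ => max (cellDeficit P t.1 t.2) 0) (t.1, vQ)) ≤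
      ∑ i : Fin T.lstar, ∑ᶠ vQ : T.VQ, σ.indicator (fun t : Fin T.lstar × T.VQ => max (cellDeficit P t.1 t.2) 0) (i, vQ) :=
    Finset.single_le_sum (f := fun i : Fin T.lstar =>
      ∑ᶠ vQ : T.VQ, σ.indicator (fun t : Fin T.lstar × T.VQ => max (cellDeficit P t.1 t.2) 0) (i, vQ))
      (fun i _ => finsum_nonneg (hnn i)) (Finset.mem_univ t.1)
  have h0 : 0 < max (cellDeficit P t.1 t.2) 0 := lt_max_of_lt_left hpos
  linarith

/-- **Strictness**: a stratum containing a cell with a positive deficit pays STRICTLY LESS than `R_∅` (so it is not licensed, and «Cor. 3.12 up to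
`R_σ`» is then a strictly stronger sentence than the proved one). [claim: Mochizuki2012, status: disputed] -/
theorem offRemainder_lt_offRemainder_empty_of_pos (H : BridgeHyps P) {σ : Set (Fin T.lstar × T.VQ)} {t : Fin T.lstar × T.VQ}
    (ht : t ∈ σ) (hpos : 0 < cellDeficit P t.1 t.2) : offRemainder P σ < offRemainder P ∅ := by
  have h := offRemainder_compl_pos_of_pos H ht hpos
  rw [offRemainder_compl_eq_sub H σ] at h
  linarith

/-- **Characterisation**: `R_σ = R_∅ ⟺` no cell of `σ` has a positive deficit. [claim: Mochizuki2012, status: disputed] -/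
theorem offRemainder_eq_offRemainder_empty_iff (H : BridgeHyps P) (σ : Set (Fin T.lstar × T.VQ)) :
    offRemainder P σ = offRemainder P ∅ ↔ ∀ t ∈ σ, cellDeficit P t.1 t.2 ≤ 0 := by
  refine ⟨fun h t ht => ?_, offRemainder_eq_offRemainder_empty_of_forall_nonpos H⟩
  by_contra hlt
  exact (offRemainder_lt_offRemainder_empty_of_pos H ht (lt_of_not_ge hlt)).ne h

/-- A cell with a positive deficit is NOT a licence cell. [claim: Mochizuki2012, status: disputed] -/
theorem notMem_licenceCells_of_pos (H : BridgeHyps P) {t : Fin T.lstar × T.VQ} (hpos : 0 < cellDeficit P t.1 t.2) :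
    t ∉ licenceCells P :=
  fun ht => (cellDeficit_nonpos_of_mem_licenceCells H ht).not_gt hpos

/-- `R_∅ = 0 ⟺` NO cell has a positive deficit (then the printed Statement holds, `statement_of_offRemainder_empty_nonpos`).
[claim: Mochizuki2012, status: disputed] -/
theorem offRemainder_empty_eq_zero_iff (H : BridgeHyps P) :
    offRemainder P (∅ : Set (Fin T.lstar × T.VQ)) = 0 ↔ ∀ t : Fin T.lstar × T.VQ, cellDeficit P t.1 t.2 ≤ 0 := by
  refine ⟨fun h t => ?_, fun h => offRemainder_eq_zero_of_forall fun t _ => h t⟩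
  by_contra hlt
  have hlt' := offRemainder_lt_offRemainder_empty_of_pos H (Set.mem_univ t) (lt_of_not_ge hlt)
  rw [offRemainder_univ, h] at hlt'
  exact lt_irrefl _ hlt'

/-! ## §7. Branch C vocabulary: the same invariance for `PilotKummerCompatHullOn` under the q-pin -/

section BranchC

variable {L : LatticeSituation T} {P' : Cor312.Setting L.toSituation}
  {ρ : (∀ v : T.V, v ∈ T.Vbad → Set (L.L.StarPacket v)) → ∀ (j : T.Label) (vQ : T.VQ), Set (L.L.Packet j vQ)}
  {qK : ∀ v : T.V, v ∈ T.Vbad → Set (L.L.StarPacket v)}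

/-- Branch C: bridge hypotheses + q-pin + S_H on `σ` ⟹ `R_σ = R_∅` (the window certificates' `hSHw`-shaped binder on a stratum never
changes the remainder's value, only its support). [claim: Mochizuki2012, status: disputed] -/
theorem offRemainder_eq_offRemainder_empty_of_pilotKummerCompatHullOn (H : BridgeHyps P') (hq : QPinned L P' ρ qK)
    {σ : Set (Fin T.lstar × T.VQ)} (h : PilotKummerCompatHullOn L P' ρ qK σ) : offRemainder P' σ = offRemainder P' ∅ :=
  offRemainder_eq_offRemainder_empty_of_licenceOn H ((pilotKummerCompatHullOn_iff_licenceOn hq σ).mp h)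

/-- Branch C, unrestricted clause: `PilotKummerCompatHull ⟹ R_∅ = 0` (every cell is licensed). [claim: Mochizuki2012, status: disputed] -/
theorem offRemainder_empty_eq_zero_of_pilotKummerCompatHull (H : BridgeHyps P') (hq : QPinned L P' ρ qK)
    (h : PilotKummerCompatHull L P' ρ qK) : offRemainder P' (∅ : Set (Fin T.lstar × T.VQ)) = 0 := by
  rw [← offRemainder_eq_offRemainder_empty_of_pilotKummerCompatHullOn H hq (pilotKummerCompatHullOn_of_pilotKummerCompatHull Set.univ h)]
  exact offRemainder_univ

end BranchC

end Summit.ABC.IUTFork.Repair.RH.SigmaLicence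

end
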